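import Summits.BirchSwinnertonDyer.BirchSwinnertonDyer.Theorems.GenusKolyvaginAtTwoPowDvdShaCardAtTwoRTPrimeLevelRung
import HarnessLib

/-!
# Route `GenusKolyvaginAtTwo`, LINE 18 `plus_descent` on L_T `PowDvdShaCardAtTwoRT` (stmt-BirchSwinnertonDyer-23242), stub 3a⁗ —
# THE K-SIDE DIRECT RUNG: NO descent, NO genus budget, NO parity bit — the Mordell–Weil line is separated from the depth-one class by
# LOCALISATION AT `λ`, so `2^{2M} ∣ #Ш(E_K/K)[2^∞]` in L_T's own currency

Seat `bsd-line-gk2-p1` g14 (LEAD seat 1/3, cell `bsd-f1-sign2`), `--supports stmt-BirchSwinnertonDyer-23242 --as helper`.  THEOREMS ONLY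
(no definition, no named fact, no `sorry`).  Nothing here closes an item; BSD is not proved by any of this.

WHY THIS FILE.  LINE 18 descends the Kolyvagin class to `ℚ` because over `K` at `2` «a `τ`-anti-invariant class of order `2` is `τ`-invariant»: the
sign cannot separate `⟨c_M(ℓ)⟩` from the Kummer image `κ(E(K))` inside `Sel^{(2^M)}(E_K/K)`, so the order of `c_M(ℓ)` in `Ш(E_K) = Sel/κ(E(K))`
seemed to lose a bit.  But at DEPTH ONE the separation is LOCAL, not a sign: by the Kolyvagin relation (route item Q2 `KolyvaginRelationAtTwo` at
`j = 0`, with `2^M ∣ y_K`) the class `c_M(ℓ)` is ENTIRELY trivial at the place `λ` of `K` above `ℓ` (`c_M(ℓ) ∈ torsionLocalKer_λ`, not merely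
Selmer), while the Kummer classes of `E(K)` are DETECTED at `λ` as soon as the Mordell–Weil generator is not `2`-divisible in `E(K_λ)` (a
Frobenius condition on `ℓ`, Chebotarev-generic — McCallum's Cor. 3.2 / the use of Prop. 5.2 with `C = E(K) ⊗ ℤ_p`).  Then `⟨c_M(ℓ)⟩ ∩ κ(E(K)) = 0`,
the image of `c_M(ℓ)` in `Ш(E_K/K)` has FULL order `2^M`, and gk2-p2's one rung over `K` (Cassels–Tate over `K`, gk2-p1 g12/g13) gives
`2^{2M} ∣ #Ш(E_K/K)[2^∞]` — for `M = M₀` this is L_T's `2^{2M₀} ∣ G` VERBATIM, with no `g`, `g′`, `C(Wd)`.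

* `addOrderOf_torsionH1ToH1_eq_of_localDetection` — general (any number field `F`, any `E/F`, any `n = 2^M`): `c ∈ Sel^{(n)}` of order `2^M`,
  `c ∈ torsionLocalKer_v` for the places `v` in a set `S`, and `S` DETECTS the Kummer image (`κ(P) ∈ ⋂_{v∈S} torsionLocalKer_v ⟹ κ(P) = 0`)
  ⟹ the image of `c` in `Ш(E/F)` has order `2^M`; `pow_two_mul_dvd_natCard_sha_of_localDetection` — hence `2^{2M} ∣ #Ш(E/F)[2^∞]`.
* **`pow_two_mul_dvd_natCard_sha_baseChange_of_primitive_prime_level`** — on the frame (`W` globally minimal, `ρ_{E,2^k}` onto ∀`k`, `∏ c_v` odd;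
  `K` imaginary quadratic, `d_K` odd `≠ −3`, Heegner; `ℓ` Kolyvagin at `2` with `1 ≤ M ≤ M(ℓ)`; data at the divisors of `ℓ`):
  **`P(ℓ) ∉ 2E(K[ℓ])`** ∧ **`c_M(ℓ) ∈ torsionLocalKer_w` at the place(s) `w ∋ ℓ`** (Q2 + `2^M ∣ y_K`) ∧ **`λ` detects `κ(E(K))`** ⟹
  **`2^{2M} ∣ #Ш(E_K/K)[2^∞]`**.  NO root-number case split, NO rank hypothesis, NO `Δ < 0`.

References: [McCallumLMS1991] §3 Cor. 3.2, §4 Lemma 4.3, Prop. 4.4, Cor. 4.5, §5 Prop. 5.2 and p. 310; [GrossLMS1991] Prop. 6.2; [Kolyvagin1989Izv] §3.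
-/

set_option autoImplicit false
-- the Theorems namespace of this sub repeats the summit name by design (D-0017 nested layout)
set_option linter.dupNamespace false

noncomputable section

open scoped Classical

namespace Summit.BirchSwinnertonDyer.BirchSwinnertonDyer.Theorems.GenusExact.PlusDescent

open NumberField WeierstrassCurve Field Literature.NumberTheory.EllipticCurves
  Literature.NumberTheory.EllipticCurves.ModularForms IsDedekindDomain AddSubgroup

/-! ## §1 Local detection separates a locally-trivial Selmer class from the Kummer image -/

section Detection

variable {F : Type} [Field F] [NumberField F] (V : WeierstrassCurve F) [V.IsElliptic]

/-- **Full order in `Ш` by local detection.**  `E/F` elliptic over a number field, `n = 2^M`; `c ∈ Sel^{(n)}(E/F)` of order `2^M`, locally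
TRIVIAL (`torsionLocalKer`) at every place of a set `S` of finite places which DETECTS the Kummer image (`κ(P)` locally trivial on `S` ⟹ `κ(P) = 0`)
(the order hypothesis is not needed for this statement).
Then the image of `c` in `H¹(F, E)` has the SAME ORDER as `c`: a multiple `k·c` dying in `H¹(F, E)` is a Kummer class (exactness,
`mem_range_kummerMapTorsion_of_torsionH1ToH1_eq_zero`), locally trivial on `S`, hence `0` — the map is injective on `ℤc`.
[cite: McCallumLMS1991, §3 Cor. 3.2 and §5 p. 310] -/
theorem addOrderOf_torsionH1ToH1_eq_of_localDetection (M : ℕ) (S : Set (HeightOneSpectrum (𝓞 F)))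
    (hdet : ∀ P : V.toAffine.Point,
      (∀ v ∈ S, kummerMapTorsion V ((2 ^ M : ℕ) : ℤ)
          (V.zsmul_geomPoints_surjective_holds (by exact_mod_cast pow_ne_zero M two_ne_zero)) P ∈
        V.torsionLocalKer (v.adicCompletion F) ((2 ^ M : ℕ) : ℤ)) →
      kummerMapTorsion V ((2 ^ M : ℕ) : ℤ)
        (V.zsmul_geomPoints_surjective_holds (by exact_mod_cast pow_ne_zero M two_ne_zero)) P = 0)
    {c : galH1Torsion V ((2 ^ M : ℕ) : ℤ)}
    (hloc : ∀ v ∈ S, c ∈ V.torsionLocalKer (v.adicCompletion F) ((2 ^ M : ℕ) : ℤ)) :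
    addOrderOf (torsionH1ToH1 V ((2 ^ M : ℕ) : ℤ) c) = addOrderOf c := by
  have hn : ((2 ^ M : ℕ) : ℤ) ≠ 0 := by exact_mod_cast pow_ne_zero M two_ne_zero
  -- `H¹(F, E[n]) → H¹(F, E)` is injective on the cyclic subgroup generated by `c`
  have hinj : ∀ k : ℤ, torsionH1ToH1 V ((2 ^ M : ℕ) : ℤ) (k • c) = 0 → k • c = 0 := by
    intro k hk
    obtain ⟨P, hP⟩ := mem_range_kummerMapTorsion_of_torsionH1ToH1_eq_zero V ((2 ^ M : ℕ) : ℤ)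
      (V.zsmul_geomPoints_surjective_holds hn) _ hk
    have hPloc : ∀ v ∈ S, kummerMapTorsion V ((2 ^ M : ℕ) : ℤ) (V.zsmul_geomPoints_surjective_holds hn) P ∈
        V.torsionLocalKer (v.adicCompletion F) ((2 ^ M : ℕ) : ℤ) := by
      intro v hv
      rw [hP]
      exact AddSubgroup.zsmul_mem _ (hloc v hv) k
    rw [← hP]
    exact hdet P hPloc
  have hinj' : Function.Injective
      ((torsionH1ToH1 V ((2 ^ M : ℕ) : ℤ)).comp (AddSubgroup.zmultiples c).subtype) := by
    refine (injective_iff_map_eq_zero _).mpr fun x hx ↦ ?_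
    obtain ⟨k, hk⟩ := AddSubgroup.mem_zmultiples_iff.mp x.2
    apply Subtype.ext
    change (x : galH1Torsion V ((2 ^ M : ℕ) : ℤ)) = 0
    rw [← hk]
    refine hinj k ?_
    rw [hk]
    exact hx
  have h1 := addOrderOf_injective _ hinj' ⟨c, AddSubgroup.mem_zmultiples c⟩
  rw [addOrderOf_mk] at h1
  exact h1

/-- **`2^{2M} ∣ #Ш(E/F)[2^∞]` by local detection** (same hypotheses, `Ш(E/F)[2^∞]` finite): the image of `c` is an element of `Ш(E/F)[2^∞]` of
order `2^M`, and gk2-p2's one rung (`sq_dvd_natCard_primaryComponent_sha_of_dvd_addOrderOf`, Cassels–Tate over `F`) squares it.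
[cite: McCallumLMS1991, §5 p. 310] -/
theorem pow_two_mul_dvd_natCard_sha_of_localDetection [Finite (AddCommGroup.primaryComponent V.sha 2)] (M : ℕ)
    (S : Set (HeightOneSpectrum (𝓞 F)))
    (hdet : ∀ P : V.toAffine.Point,
      (∀ v ∈ S, kummerMapTorsion V ((2 ^ M : ℕ) : ℤ)
          (V.zsmul_geomPoints_surjective_holds (by exact_mod_cast pow_ne_zero M two_ne_zero)) P ∈
        V.torsionLocalKer (v.adicCompletion F) ((2 ^ M : ℕ) : ℤ)) →
      kummerMapTorsion V ((2 ^ M : ℕ) : ℤ)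
        (V.zsmul_geomPoints_surjective_holds (by exact_mod_cast pow_ne_zero M two_ne_zero)) P = 0)
    {c : galH1Torsion V ((2 ^ M : ℕ) : ℤ)} (hc : c ∈ selmerGroup V ((2 ^ M : ℕ) : ℤ)) (hca : addOrderOf c = 2 ^ M)
    (hloc : ∀ v ∈ S, c ∈ V.torsionLocalKer (v.adicCompletion F) ((2 ^ M : ℕ) : ℤ)) :
    2 ^ (2 * M) ∣ Nat.card (AddCommGroup.primaryComponent V.sha 2) := by
  haveI : Fact (Nat.Prime 2) := ⟨Nat.prime_two⟩
  have hn : ((2 ^ M : ℕ) : ℤ) ≠ 0 := by exact_mod_cast pow_ne_zero M two_ne_zero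
  set z := torsionH1ToH1 V ((2 ^ M : ℕ) : ℤ) c with hz
  have hz_sha : z ∈ V.sha := torsionH1ToH1_mem_sha_of_mem_selmerGroup V hn hc
  have hz_ord : addOrderOf z = 2 ^ M := by
    rw [hz, addOrderOf_torsionH1ToH1_eq_of_localDetection V M S hdet hloc, hca]
  have hz_ord' : addOrderOf (⟨z, hz_sha⟩ : V.sha) = 2 ^ M := by rw [← hz_ord]; exact addOrderOf_mk z hz_sha
  have hmem : (⟨z, hz_sha⟩ : V.sha) ∈ AddCommGroup.primaryComponent V.sha 2 :=
    (AddCommGroup.mem_primaryComponent_iff_addOrderOf (G := V.sha) (p := 2)).mpr ⟨M, hz_ord'⟩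
  have hz2 : 2 ^ M ∣ addOrderOf (⟨⟨z, hz_sha⟩, hmem⟩ : AddCommGroup.primaryComponent V.sha 2) := by
    rw [addOrderOf_mk, hz_ord']
  exact sq_dvd_natCard_primaryComponent_sha_of_dvd_addOrderOf V 2 hz2

end Detection

/-! ## §2 The K-side direct rung at a deep primitive prime level -/

section Frame

variable {W : WeierstrassCurve ℚ} [NeZero (W.conductorNorm ℤ)] {K : Type} [Field K] [NumberField K]
  {Dt : ModularParametrizationData W (W.conductorNorm ℤ)} {β : ℤ} {ι : K →+* ℂ}

/-- **THE K-SIDE DIRECT RUNG (L_T's currency, no lost bit).**  `W/ℚ` globally minimal with `ρ_{E,2^k}` onto for every `k` and `∏ c_v(W)` odd; `K`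
imaginary quadratic with odd `d_K ≠ −3` and the Heegner hypothesis; `Ш(E_K/K)[2^∞]` finite; `ℓ` a Kolyvagin prime at `2` with `1 ≤ M ≤ M(ℓ)`; data
at the divisors of `ℓ`.  IF `P(ℓ) ∉ 2E(K[ℓ])` (a depth-one certificate at index `≥ M`), `c_M(ℓ)` is locally TRIVIAL at the place(s) of `K` above `ℓ`
(the Kolyvagin relation Q2 with `2^M ∣ y_K`), and those places DETECT the Kummer image of `E(K)` (the Mordell–Weil generator is not `2`-divisible in
`E(K_λ)`: a Frobenius condition on `ℓ`), THEN **`2^{2M} ∣ #Ш(E_K/K)[2^∞]`** — at `M = M₀` literally L_T's conclusion.  Chain: ORDER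
(`addOrderOf_kolyvaginClass_two_eq_pow_of_not_two_dvd`) → Selmer over `K` (fkl-p1 Lemma 4.3 at `2` off `ℓ`; complex places; `torsionLocalKer ≤
selmerLocalKer` at `λ`) → §1.  [cite: McCallumLMS1991, §3 Cor. 3.2, §4 Cor. 4.5, §5 p. 310] [cite: GrossLMS1991, Prop. 6.2] [cite: Kolyvagin1989Izv, §3] -/
theorem pow_two_mul_dvd_natCard_sha_baseChange_of_primitive_prime_level [W.IsElliptic] [W.IsGloballyMinimal]
    (hK : IsImaginaryQuadratic K) (hodd : Odd (NumberField.discr K)) (h3 : NumberField.discr K ≠ -3)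
    (hH : SatisfiesHeegnerHypothesis (W.conductorNorm ℤ) K) (hsurj : ∀ k : ℕ, W.HasSurjectiveModNGaloisRep ((2 ^ k : ℕ) : ℤ))
    (hT : Odd W.tamagawaProduct) [Finite (AddCommGroup.primaryComponent (W.baseChange K).sha 2)]
    {ℓ M : ℕ} (hℓ : ℓ.Prime) (hM : 1 ≤ M)
    (hkol : Zhang2014.IsKolyvaginPrime (W.conductorNorm ℤ) W K 2 ℓ ∧ M ≤ Zhang2014.kolyvaginIndex W 2 ℓ)
    (d : (m : ℕ) → m ∣ ℓ → KolyvaginHeegnerData Dt β ι m)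
    (hprim : ¬ ∃ Q : (W.baseChange (ringClassField K ι ℓ)).toAffine.Point, (2 : ℤ) • Q = (d ℓ dvd_rfl).derivedPoint)
    (hlocℓ : ∀ w : HeightOneSpectrum (𝓞 K), (ℓ : 𝓞 K) ∈ w.asIdeal →
      (d ℓ dvd_rfl).kolyvaginClass Nat.prime_two M ∈ (W.baseChange K).torsionLocalKer (w.adicCompletion K) ((2 ^ M : ℕ) : ℤ))
    (hdet : ∀ P : (W.baseChange K).toAffine.Point,
      (∀ w : HeightOneSpectrum (𝓞 K), (ℓ : 𝓞 K) ∈ w.asIdeal →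
        kummerMapTorsion (W.baseChange K) ((2 ^ M : ℕ) : ℤ)
            ((W.baseChange K).zsmul_geomPoints_surjective_holds (by exact_mod_cast pow_ne_zero M two_ne_zero)) P ∈
          (W.baseChange K).torsionLocalKer (w.adicCompletion K) ((2 ^ M : ℕ) : ℤ)) →
      kummerMapTorsion (W.baseChange K) ((2 ^ M : ℕ) : ℤ)
        ((W.baseChange K).zsmul_geomPoints_surjective_holds (by exact_mod_cast pow_ne_zero M two_ne_zero)) P = 0) :
    2 ^ (2 * M) ∣ Nat.card (AddCommGroup.primaryComponent (W.baseChange K).sha 2) := by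
  haveI hEK : (W.baseChange K).IsElliptic := by rw [WeierstrassCurve.baseChange]; infer_instance
  have hsq : Squarefree ℓ := hℓ.squarefree
  have hkol' : ∀ q ∈ ℓ.primeFactors,
      Zhang2014.IsKolyvaginPrime (W.conductorNorm ℤ) W K 2 q ∧ M ≤ Zhang2014.kolyvaginIndex W 2 q := by
    intro q hq
    rw [hℓ.primeFactors, Finset.mem_singleton] at hq
    subst hq
    exact hkol
  have hD4 : NumberField.discr K ≠ -4 := by
    intro h
    rw [h] at hodd
    exact (Int.not_even_iff_odd.mpr hodd) ⟨-2, by norm_num⟩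
  have hsurj1 : W.HasSurjectiveModNGaloisRep ((2 : ℤ) ^ 1) := by simpa using hsurj 1
  -- order `2^M`
  have hord := addOrderOf_kolyvaginClass_two_eq_pow_of_not_two_dvd hK hodd h3 hH hsurj1 hsq hM hkol' d hprim
  -- Selmer over `K`
  have hsel : (d ℓ dvd_rfl).kolyvaginClass Nat.prime_two M ∈ selmerGroup (W.baseChange K) ((2 ^ M : ℕ) : ℤ) := by
    rw [mem_selmerGroup_iff]
    refine ⟨fun w ↦ ?_, fun w ↦ mem_selmerLocalKer_infinitePlace_of_isImaginaryQuadratic hK _ w _⟩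
    by_cases hw : (ℓ : 𝓞 K) ∈ w.asIdeal
    · exact (W.baseChange K).torsionLocalKer_le_selmerLocalKer (w.adicCompletion K) _ (hlocℓ w hw)
    · exact RankOneAtTwoOneDoor.kolyvaginClass_two_mem_selmerLocalKer_of_odd_tamagawaProduct W hsurj hT K hK h3 hD4 hH
        Dt β ι M hsq hkol' (d ℓ dvd_rfl) w hw
  exact pow_two_mul_dvd_natCard_sha_of_localDetection (W.baseChange K) M {w | (ℓ : 𝓞 K) ∈ w.asIdeal} hdet hsel hord
    (fun w hw ↦ hlocℓ w hw)

end Frame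

end Summit.BirchSwinnertonDyer.BirchSwinnertonDyer.Theorems.GenusExact.PlusDescent

end
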